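import Summits.CriticalPhenomena.SAWScalingLimit.Theorems.SAWDefectDecoherenceObservableToSLERResidueAssemblyMacro
import Summits.CriticalPhenomena.SAWScalingLimit.Theorems.SAWDevelopingMapObservableToSLETypeLadderCarvedReductionSqueezeGeometry
import Summits.CriticalPhenomena.SAWScalingLimit.Theorems.SAWDevelopingMapObservableToSLETypeLadderCarvedReductionSqueezeRatio
import HarnessLib

/-!
# The solid moving-carving squeeze T2b″, assembled, and THE THREE-ITEM RESIDUE ASSEMBLY of the crux `ObservableToSLER`
# (stmt-CriticalPhenomena-14005, line `bridge-gate-renewal`; `Iff.rfl`-identical to `SAWDevelopingMap.ObservableToSLE`, stmt-10472)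

Landing target: `Summits/CriticalPhenomena/SAWScalingLimit/Theorems/SAWDefectDecoherenceObservableToSLERResidueAssembly3.lean`
(`--supports stmt-CriticalPhenomena-14005`; lead prover-line-stmt-CriticalPhenomena-14005-c4-0, skeleton r16).

With the twin lead's landing of the squeeze geometry T-A (`TypeLadder.carvedReduction_squeezeGeometry`, p163006) every PROVABLE stub
of the merged line skeleton (14005 `Lines/bridge_gate_renewal.lean` r16 ≡ 10472 `Lines/six_class_type_ladder.lean`) has landed.  This
file records the consequence at Theorems level:

* `Squeeze.carvedReduction_squeezeSolid` — T2b″, the solid moving-carving squeeze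
  `TwoPieceAdmRestrictionLimit → MovingCarvingSqueezeP FatAnchoredClassZeroSolid` (statement = the registered stub
  `stub_carvedReduction_squeezeSolid` of both skeletons, verbatim; GLUE over T-A and T-B `TypeLadder.stub_carvedReduction_ratioSqueeze` p131716);
* `Residue.observableToSLER_of_residue3` — **the crux from EXACTLY the three research items of the ledger**:
  S1 `NestedRenewalFatCoSolidR` (item stmt-CriticalPhenomena-17698, verbatim), T1⁻ `MacroSourceLocality` (item stmt-CriticalPhenomena-17955,
  verbatim), T5ₐ `HexSimpleSubseqLimits` (item stmt-CriticalPhenomena-7148, by name) — the weakened-anchor residue assembly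
  `Residue.observableToSLER_of_residueMacro` (p148257) with its squeeze hypothesis discharged.

So after this file the crux chain `ObservableToSLER` ⇐ {17698, 17955, 7148} is kernel-certified with no private stub left; 17955 and 7148
are consequences of DCS Conjecture 1 in substance, 17698 (two-ended renewal abundance at a general root) is the one input that is not
(`Cruxes/ObservableToSLER/Lines/bridge-gate-renewal-S1-residue.md`).
-/

noncomputable section

open scoped BigOperators Topology NNReal ENNReal Classical BoundedContinuousFunction ComplexConjugate
open Filter Set MeasureTheory Metric
open Literature.Probability.LatticeModels (HexVertex hexGraph hexCenter triZeta triEmbed Site polyline)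
open Literature.Probability.RandomPlanarGeometry
open Literature.Probability.RandomPlanarGeometry.SAW
open UpperHalfPlane (upperHalfPlaneSet)

namespace Summit.CriticalPhenomena.SAWScalingLimit.Theorems.ObservableToSLER.Squeeze

open Summit.CriticalPhenomena.SAWScalingLimit.Theses.SAWDefectDecoherence
  (HexObservableLimitR HexTight ObservableToSLER)
open Summit.CriticalPhenomena.SAWScalingLimit.Theorems.ObservableToSLER.BridgeGate
open Summit.CriticalPhenomena.SAWScalingLimit.Theorems.ObservableToSLER.NestedGate

/-- **T2b″, THE SOLID MOVING-CARVING SQUEEZE** `TwoPieceAdmRestrictionLimit → MovingCarvingSqueezeP FatAnchoredClassZeroSolid`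
(statement = the registered stub `stub_carvedReduction_squeezeSolid` of the line skeletons of 14005 / 10472, verbatim):
GLUE over the landed T-A `TypeLadder.carvedReduction_squeezeGeometry` (p163006, twin lead 10472 c5; its leaves: selection p137830,
domainsCoreF p162460 over confinedOuterHull p147799, lattice2 p154374) and the landed T-B `TypeLadder.stub_carvedReduction_ratioSqueeze` (p131716). -/
theorem carvedReduction_squeezeSolid :
    (∀ (D D' : DobrushinDomain) (ρ : ℝ) (φ : ConformalEquiv upperHalfPlaneSet D.carrier)
      (Φ : ConformalEquiv (upperHalfPlaneSet \ φ.pullbackHull D') upperHalfPlaneSet) (d : ℝ)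
      (Λ Λ' : ℝ → Finset HexVertex) (m₀ m₁ m₁' : ℝ → ℤ) (a b : ℝ → Sym2 HexVertex),
      (0 < ρ ∧ ∀ i : Fin 2, D.carrier ∩ ball (D.pt i) ρ = {z : ℂ | (D.pt i).im < z.im} ∩ ball (D.pt i) ρ) →
      D.IsHullSubdomain D' → D.IsChordalUniformizing φ →
      IsRestrictionMap (φ.pullbackHull D') Φ → HasRestrictionDeriv (φ.pullbackHull D') Φ d →
      (∀ᶠ δ : ℝ in 𝓝[>] 0,
        Λ' δ ⊆ Λ δ ∧ hexDomainSimplyConnected (Λ δ) ∧ hexDomainSimplyConnected (Λ' δ) ∧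
        (hexGraph.induce (↑(Λ δ) : Set HexVertex)).Preconnected ∧
        (hexGraph.induce (↑(Λ' δ) : Set HexVertex)).Preconnected ∧
        a δ ∈ hexDomainBoundary (Λ δ) ∧ b δ ∈ hexDomainBoundary (Λ δ) ∧
        a δ ∈ hexDomainBoundary (Λ' δ) ∧ b δ ∈ hexDomainBoundary (Λ' δ) ∧
        Nonempty (HexMidEdgeSAW (Λ' δ) (a δ) (b δ)) ∧
        (∀ v ∈ Λ δ, (δ : ℂ) * hexCenter v ∈ D.carrier) ∧
        (∀ v ∈ Λ' δ, (δ : ℂ) * hexCenter v ∈ D'.carrier) ∧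
        (∀ v : HexVertex, (δ : ℂ) * hexCenter v ∈ ball (D.pt 0) ρ →
          ((v ∈ Λ δ ↔ m₀ δ ≤ v.1 1) ∧ (v ∈ Λ' δ ↔ m₀ δ ≤ v.1 1))) ∧
        (∀ v : HexVertex, (δ : ℂ) * hexCenter v ∈ ball (D.pt 1) ρ →
          ((v ∈ Λ δ ↔ m₁ δ ≤ v.1 1) ∧ (v ∈ Λ' δ ↔ m₁' δ ≤ v.1 1)))) →
      (∀ K : Set ℂ, IsCompact K → K ⊆ D.carrier →
        ∀ᶠ δ : ℝ in 𝓝[>] 0, ∀ v : HexVertex, (δ : ℂ) * hexCenter v ∈ K → v ∈ Λ δ) →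
      (∀ K : Set ℂ, IsCompact K → K ⊆ D'.carrier →
        ∀ᶠ δ : ℝ in 𝓝[>] 0, ∀ v : HexVertex, (δ : ℂ) * hexCenter v ∈ K → v ∈ Λ' δ) →
      Tendsto (fun δ : ℝ => (δ : ℂ) * hexMidpoint (a δ)) (𝓝[>] 0) (𝓝 (D.pt 0)) →
      Tendsto (fun δ : ℝ => (δ : ℂ) * hexMidpoint (b δ)) (𝓝[>] 0) (𝓝 (D.pt 1)) →
      Tendsto (fun δ : ℝ =>
          (∑ γ : HexMidEdgeSAW (Λ' δ) (a δ) (b δ), hexCriticalFugacity ^ γ.length) /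
            (∑ γ : HexMidEdgeSAW (Λ δ) (a δ) (b δ), hexCriticalFugacity ^ γ.length)) (𝓝[>] 0)
        (𝓝 (d ^ ((5 : ℝ) / 8)))) →
    (∀ (D : DobrushinDomain) (a b : ℝ → HexVertex), IsEmbEndpointApprox hexGraph hexCenter D a b →
      ∀ η > (0 : ℝ), ∃ R₀ > (0 : ℝ), ∀ R ∈ Set.Ioc (0 : ℝ) R₀, ∀ ρ > (0 : ℝ), ∀ N : ℕ,
          ∀ (δ : ℕ → ℝ) (S T : ℕ → ℕ → Set HexVertex) (n n' : ℕ → ℕ) (q q' : ℕ → HexVertex),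
            Tendsto δ atTop (𝓝[>] 0) →
            (∀ k, TameNestedFamily (δ k) R N (a (δ k)) (S k) ∧
              TameNestedFamily (δ k) R N (b (δ k)) (T k) ∧
              (((∀ i, ExteriorAnchored D.carrier (δ k) (S k i) (a (δ k))) ∧
          (∀ i, ExteriorAnchored D.carrier (δ k) (T k i) (b (δ k))) ∧
          (∀ (i : ℕ) (p q : HexVertex), HasCleanWindow D.carrier (δ k) ρ (S k i) p q →
            rowOf 0 q = rowOf 0 p + 1 ∧
              ∀ x : HexVertex, ((δ k : ℝ) : ℂ) * hexCenter x ∈ ball (((δ k : ℝ) : ℂ) * hexCenter q) ρ →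
                (x ∈ S k i ↔ rowOf 0 x ≤ rowOf 0 p)) ∧
          (∀ (i : ℕ) (p q : HexVertex), HasCleanWindow D.carrier (δ k) ρ (T k i) p q →
            rowOf 0 q = rowOf 0 p + 1 ∧
              ∀ x : HexVertex, ((δ k : ℝ) : ℂ) * hexCenter x ∈ ball (((δ k : ℝ) : ℂ) * hexCenter q) ρ →
                (x ∈ T k i ↔ rowOf 0 x ≤ rowOf 0 p))) ∧
          (∀ (i : ℕ) (p q : HexVertex), HasCleanWindow D.carrier (δ k) ρ (S k i) p q →
            ∃ K : Set ℂ, IsCompact K ∧ IsConnected K ∧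
              ((δ k : ℝ) : ℂ) * hexCenter q - ((ρ / 2 : ℝ) : ℂ) * Complex.I ∈ K ∧ ((δ k : ℝ) : ℂ) * hexCenter (a (δ k)) ∈ K ∧
              ∀ v : HexVertex, Metric.infDist (((δ k : ℝ) : ℂ) * hexCenter v) K ≤ ρ / 4 → v ∈ S k i) ∧
          (∀ (i : ℕ) (p q : HexVertex), HasCleanWindow D.carrier (δ k) ρ (T k i) p q →
            ∃ K : Set ℂ, IsCompact K ∧ IsConnected K ∧
              ((δ k : ℝ) : ℂ) * hexCenter q - ((ρ / 2 : ℝ) : ℂ) * Complex.I ∈ K ∧ ((δ k : ℝ) : ℂ) * hexCenter (b (δ k)) ∈ K ∧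
              ∀ v : HexVertex, Metric.infDist (((δ k : ℝ) : ℂ) * hexCenter v) K ≤ ρ / 4 → v ∈ T k i) ∧
          (∀ i : ℕ, ∃ K : Set ℂ, IsCompact K ∧ IsConnected K ∧ ((δ k : ℝ) : ℂ) * hexCenter (a (δ k)) ∈ K ∧
            (∀ v : HexVertex, Metric.infDist (((δ k : ℝ) : ℂ) * hexCenter v) K ≤ ρ / 8 → v ∈ S k i) ∧
            (∀ v ∈ S k i, ∃ (t w : HexVertex) (r : ℕ), v ∈ hexBall t r ∧ w ∈ hexBall t r ∧
              hexBall t r ⊆ S k i ∧ Metric.infDist (((δ k : ℝ) : ℂ) * hexCenter w) K ≤ ρ / 16)) ∧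
          (∀ i : ℕ, ∃ K : Set ℂ, IsCompact K ∧ IsConnected K ∧ ((δ k : ℝ) : ℂ) * hexCenter (b (δ k)) ∈ K ∧
            (∀ v : HexVertex, Metric.infDist (((δ k : ℝ) : ℂ) * hexCenter v) K ≤ ρ / 8 → v ∈ T k i) ∧
            (∀ v ∈ T k i, ∃ (t w : HexVertex) (r : ℕ), v ∈ hexBall t r ∧ w ∈ hexBall t r ∧
              hexBall t r ⊆ T k i ∧ Metric.infDist (((δ k : ℝ) : ℂ) * hexCenter w) K ≤ ρ / 16)))) →
            (∀ k, ∃ (γ : HexDomainSAW D.carrier (δ k) (a (δ k)) (b (δ k))) (m : ℕ) (p : HexVertex)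
                (m' : ℕ) (p' : HexVertex),
              IsFirstGoodGateN D.carrier (δ k) ρ R (S k) (a (δ k)) γ.walk.support (n k) m p (q k) ∧
              IsFirstGoodGateN D.carrier (δ k) ρ R (T k) (b (δ k)) γ.walk.support.reverse
                (n' k) m' p' (q' k) ∧
              WideLink D.carrier (δ k) ρ (S k (n k) ∪ T k (n' k)) (q k) (q' k)) →
            ∀ ε' > (0 : ℝ), ∀ φ : ℕ → ℕ, StrictMono φ →
              ∃ (ψ : ℕ → ℕ) (M : DobrushinDomain) (τ : ℂ) (ρ' : ℝ) (Λ' : ℝ → Finset HexVertex)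
                (m : Fin 2 → ℝ → ℤ) (a' b' : ℝ → Sym2 HexVertex) (x : ℕ → Site 2)
                (Λ'' : ℕ → Finset HexVertex) (pu pv : ℕ → HexVertex),
                StrictMono ψ ∧
                (∀ t : ℝ, dist (M.boundary t + τ) (D.boundary t) ≤ η) ∧
                dist (M.pt 0 + τ) (D.pt 0) ≤ η ∧ dist (M.pt 1 + τ) (D.pt 1) ≤ η ∧
                (0 < ρ' ∧ ∀ i : Fin 2,
                  M.carrier ∩ ball (M.pt i) ρ' = {z : ℂ | (M.pt i).im < z.im} ∩ ball (M.pt i) ρ') ∧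
                (∀ᶠ δ' : ℝ in 𝓝[>] 0, hexDomainSimplyConnected (Λ' δ') ∧
                  a' δ' ∈ hexDomainBoundary (Λ' δ') ∧ b' δ' ∈ hexDomainBoundary (Λ' δ') ∧
                  Nonempty (HexMidEdgeSAW (Λ' δ') (a' δ') (b' δ')) ∧
                  (hexGraph.induce (↑(Λ' δ') : Set HexVertex)).Preconnected ∧
                  (∀ v ∈ Λ' δ', (δ' : ℂ) * hexCenter v ∈ M.carrier) ∧
                  (∀ i : Fin 2, ∀ v : HexVertex, (δ' : ℂ) * hexCenter v ∈ ball (M.pt i) ρ' →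
                    (v ∈ Λ' δ' ↔ m i δ' ≤ v.1 1))) ∧
                (∀ K : Set ℂ, IsCompact K → K ⊆ M.carrier →
                  ∀ᶠ δ' : ℝ in 𝓝[>] 0, ∀ v : HexVertex, (δ' : ℂ) * hexCenter v ∈ K → v ∈ Λ' δ') ∧
                Tendsto (fun δ' : ℝ => (δ' : ℂ) * hexMidpoint (a' δ')) (𝓝[>] 0) (𝓝 (M.pt 0)) ∧
                Tendsto (fun δ' : ℝ => (δ' : ℂ) * hexMidpoint (b' δ')) (𝓝[>] 0) (𝓝 (M.pt 1)) ∧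
                Tendsto (fun j : ℕ => ((δ (φ (ψ j)) : ℝ) : ℂ) *
                  Literature.Probability.LatticeModels.triEmbed (x j)) atTop (𝓝 τ) ∧
                (∀ j : ℕ,
                  (∀ w : HexVertex, w ∈ Λ'' j ↔ ((-(x j) + w.1, w.2) : HexVertex) ∈ Λ' (δ (φ (ψ j)))) ∧
                  (∀ w ∈ Λ'' j, w ∉ S (φ (ψ j)) (n (φ (ψ j))) ∪ T (φ (ψ j)) (n' (φ (ψ j)))) ∧
                  (∀ w ∈ Λ'' j, ∀ y ∈ Λ'' j, hexGraph.Adj w y →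
                    (hexDomainGraph D.carrier (δ (φ (ψ j)))).Adj w y) ∧
                  q (φ (ψ j)) ∈ Λ'' j ∧
                  pu j ∈ S (φ (ψ j)) (n (φ (ψ j))) ∪ T (φ (ψ j)) (n' (φ (ψ j))) ∧
                  pv j ∈ S (φ (ψ j)) (n (φ (ψ j))) ∪ T (φ (ψ j)) (n' (φ (ψ j))) ∧
                  hexGraph.Adj (q (φ (ψ j))) (pu j) ∧
                  s(q (φ (ψ j)), pu j) ≠ s(q' (φ (ψ j)), pv j) ∧
                  (a' (δ (φ (ψ j)))).map (fun w : HexVertex => ((x j + w.1, w.2) : HexVertex)) =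
                    s(q (φ (ψ j)), pu j) ∧
                  (b' (δ (φ (ψ j)))).map (fun w : HexVertex => ((x j + w.1, w.2) : HexVertex)) =
                    s(q' (φ (ψ j)), pv j)) ∧
                (∀ᶠ j : ℕ in atTop, 1 - ε' ≤
                  (carvedLaw D.carrier (δ (φ (ψ j))) (S (φ (ψ j)) (n (φ (ψ j))) ∪ T (φ (ψ j)) (n' (φ (ψ j))))
                    (q (φ (ψ j))) (q' (φ (ψ j))) {ξ | ∀ w ∈ ξ.walk.support, w ∈ Λ'' j}).toReal)) := by
  intro hARL D a b hab η hη
  obtain ⟨R₀, hR₀, hmain⟩ :=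
    Summit.CriticalPhenomena.SAWScalingLimit.Theorems.ObservableToSLE.TypeLadder.carvedReduction_squeezeGeometry D a b hab η hη
  refine ⟨R₀, hR₀, fun R hR ρ hρ N δ S T n n' q q' hδ hfam hgates ε' hε' φ hφ => ?_⟩
  obtain ⟨ψ, M, τ, ρ', Λ', m, a', b', x, Λ'', pu, pv, h1, h2, h3, h4, h5, h6, h7, h8, h9, h10, h11,
    E, ρE, φE, Φ, d, Nf, m₀, m₁, m₁', hflat, hHull, hφE, hΦ, hd, hlev, hadm, hexhE, hexhM, haE, hbE, hcell⟩ :=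
    hmain R hR ρ hρ N δ S T n n' q q' hδ hfam hgates ε' hε' φ hφ
  refine ⟨ψ, M, τ, ρ', Λ', m, a', b', x, Λ'', pu, pv, h1, h2, h3, h4, h5, h6, h7, h8, h9, h10, h11, ?_⟩
  exact Summit.CriticalPhenomena.SAWScalingLimit.Theorems.ObservableToSLE.TypeLadder.stub_carvedReduction_ratioSqueeze hARL D.carrier (fun j => δ (φ (ψ j)))
    (fun j => S (φ (ψ j)) (n (φ (ψ j))) ∪ T (φ (ψ j)) (n' (φ (ψ j)))) (fun j => q (φ (ψ j)))
    (fun j => q' (φ (ψ j))) pu pv x Λ'' E M ρE φE Φ d Nf Λ' m₀ m₁ m₁' a' b' ε' D.isBounded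
    (hδ.comp (hφ.comp h1).tendsto_atTop) hflat hHull hφE hΦ hd hlev hadm hexhE hexhM haE hbE hcell

end Summit.CriticalPhenomena.SAWScalingLimit.Theorems.ObservableToSLER.Squeeze

namespace Summit.CriticalPhenomena.SAWScalingLimit.Theorems.ObservableToSLER.Residue

open Summit.CriticalPhenomena.SAWScalingLimit.Theses.SAWDefectDecoherence (HexObservableLimitR HexTight ObservableToSLER)
open Summit.CriticalPhenomena.SAWScalingLimit.Theorems.ObservableToSLER.BridgeGate
open Summit.CriticalPhenomena.SAWScalingLimit.Theorems.ObservableToSLER.NestedGate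

/-- **THE THREE-ITEM RESIDUE ASSEMBLY.**  The crux `ObservableToSLER` (stmt-CriticalPhenomena-14005; `Iff.rfl`-identical to
`SAWDevelopingMap.ObservableToSLE`, stmt-10472) follows from EXACTLY the three research items of the ledger:
(S1) `NestedRenewalFatCoSolidR` = item stmt-CriticalPhenomena-17698 (two-ended renewal abundance, verbatim),
(T1⁻) `MacroSourceLocality` = item stmt-CriticalPhenomena-17955 (macroscopic source locality at a flat root, verbatim),
(T5ₐ) `HexSimpleSubseqLimits` = item stmt-CriticalPhenomena-7148 (simplicity of subsequential limits, by name) —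
the weakened-anchor residue assembly `observableToSLER_of_residueMacro` (p148257) with its fourth hypothesis, the solid
moving-carving squeeze T2b″, DISCHARGED by `Squeeze.carvedReduction_squeezeSolid`. -/
theorem observableToSLER_of_residue3 :
    (∀ (D : DobrushinDomain) (a b : ℝ → HexVertex), IsEmbEndpointApprox hexGraph hexCenter D a b → ∀ ε > (0 :
      ℝ), ∃ R₂ > (0 : ℝ), ∀ R ∈ Set.Ioc (0 : ℝ) R₂, ∃ ρ > (0 : ℝ), ∃ N : ℕ, ∀ᶠ δ : ℝ in 𝓝[>] 0, ∃ S T : ℕ →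
      Set HexVertex, TameNestedFamily δ R N (a δ) S ∧ TameNestedFamily δ R N (b δ) T ∧ ((∀ n, ExteriorAnchored
      D.carrier δ (S n) (a δ)) ∧ (∀ n, ExteriorAnchored D.carrier δ (T n) (b δ)) ∧ ∃ j : Fin 6, ((∀ (n : ℕ) (p
      q : HexVertex), HasCleanWindow D.carrier δ ρ (S n) p q → rowOf j q = rowOf j p + 1 ∧ ∀ x : HexVertex, (δ
      : ℂ) * hexCenter x ∈ ball ((δ : ℂ) * hexCenter q) ρ → (x ∈ S n ↔ rowOf j x ≤ rowOf j p)) ∧ (∀ (n : ℕ) (p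
      q : HexVertex), HasCleanWindow D.carrier δ ρ (T n) p q → rowOf j q = rowOf j p + 1 ∧ ∀ x : HexVertex, (δ
      : ℂ) * hexCenter x ∈ ball ((δ : ℂ) * hexCenter q) ρ → (x ∈ T n ↔ rowOf j x ≤ rowOf j p))) ∧ (∀ (n : ℕ)
      (p q : HexVertex), HasCleanWindow D.carrier δ ρ (S n) p q → ∃ K : Set ℂ, IsCompact K ∧ IsConnected K ∧
      (δ : ℂ) * hexCenter q - ((ρ / 2 : ℝ) : ℂ) * Complex.I * triZeta ^ (j : ℕ) ∈ K ∧ (δ : ℂ) * hexCenter (a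
      δ) ∈ K ∧ ∀ v : HexVertex, Metric.infDist ((δ : ℂ) * hexCenter v) K ≤ ρ / 4 → v ∈ S n) ∧ (∀ (n : ℕ) (p q
      : HexVertex), HasCleanWindow D.carrier δ ρ (T n) p q → ∃ K : Set ℂ, IsCompact K ∧ IsConnected K ∧ (δ :
      ℂ) * hexCenter q - ((ρ / 2 : ℝ) : ℂ) * Complex.I * triZeta ^ (j : ℕ) ∈ K ∧ (δ : ℂ) * hexCenter (b δ) ∈ K
      ∧ ∀ v : HexVertex, Metric.infDist ((δ : ℂ) * hexCenter v) K ≤ ρ / 4 → v ∈ T n) ∧ (∀ n : ℕ, ∃ K : Set ℂ,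
      IsCompact K ∧ IsConnected K ∧ (δ : ℂ) * hexCenter (a δ) ∈ K ∧ (∀ v : HexVertex, Metric.infDist ((δ : ℂ)
      * hexCenter v) K ≤ ρ / 8 → v ∈ S n) ∧ (∀ v ∈ S n, ∃ (t w : HexVertex) (r : ℕ), v ∈ hexBall t r ∧ w ∈
      hexBall t r ∧ hexBall t r ⊆ S n ∧ Metric.infDist ((δ : ℂ) * hexCenter w) K ≤ ρ / 16)) ∧ (∀ n : ℕ, ∃ K :
      Set ℂ, IsCompact K ∧ IsConnected K ∧ (δ : ℂ) * hexCenter (b δ) ∈ K ∧ (∀ v : HexVertex, Metric.infDist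
      ((δ : ℂ) * hexCenter v) K ≤ ρ / 8 → v ∈ T n) ∧ (∀ v ∈ T n, ∃ (t w : HexVertex) (r : ℕ), v ∈ hexBall t r
      ∧ w ∈ hexBall t r ∧ hexBall t r ⊆ T n ∧ Metric.infDist ((δ : ℂ) * hexCenter w) K ≤ ρ / 16))) ∧ hexSAWLaw
      D.carrier δ (a δ) (b δ) {γ | ¬ ∃ (n m : ℕ) (p q : HexVertex) (n' m' : ℕ) (p' q' : HexVertex),
      IsFirstGoodGateN D.carrier δ ρ R S (a δ) γ.walk.support n m p q ∧ IsFirstGoodGateN D.carrier δ ρ R T (b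
      δ) γ.walk.support.reverse n' m' p' q' ∧ WideLink D.carrier δ ρ (S n ∪ T n') q q'} ≤ ENNReal.ofReal ε) →
      (∀ (E : DobrushinDomain) (ρ : ℝ) (Λ : ℝ → Finset HexVertex) (m₀ : ℝ → ℤ) (a : ℝ → Sym2 HexVertex), 0 < ρ
      → E.carrier ∩ ball (E.pt 0) ρ = {z : ℂ | (E.pt 0).im < z.im} ∩ ball (E.pt 0) ρ → (∀ᶠ δ : ℝ in 𝓝[>] 0,
      hexDomainSimplyConnected (Λ δ) ∧ (hexGraph.induce (↑(Λ δ) : Set HexVertex)).Preconnected ∧ a δ ∈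
      hexDomainBoundary (Λ δ) ∧ (∀ v ∈ Λ δ, (δ : ℂ) * hexCenter v ∈ E.carrier) ∧ (∀ v : HexVertex, (δ : ℂ) *
      hexCenter v ∈ ball (E.pt 0) ρ → (v ∈ Λ δ ↔ m₀ δ ≤ v.1 1))) → (∀ K : Set ℂ, IsCompact K → K ⊆ E.carrier →
      ∀ᶠ δ : ℝ in 𝓝[>] 0, ∀ v : HexVertex, (δ : ℂ) * hexCenter v ∈ K → v ∈ Λ δ) → Tendsto (fun δ : ℝ => (δ :
      ℂ) * hexMidpoint (a δ)) (𝓝[>] 0) (𝓝 (E.pt 0)) → ∀ ε : ℝ, 0 < ε → ∀ r : ℝ, 0 < r → ∃ t₀ : ℝ, 0 < t₀ ∧ ∀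
      (s : ℝ → Sym2 HexVertex) (t : ℝ), t ≠ 0 → |t| < t₀ → (∀ᶠ δ : ℝ in 𝓝[>] 0, s δ ∈ hexDomainBoundary (Λ δ)
      ∧ (hexMidpoint (s δ)).im = (hexMidpoint (a δ)).im) → Tendsto (fun δ : ℝ => (δ : ℂ) * hexMidpoint (s δ))
      (𝓝[>] 0) (𝓝 (E.pt 0 + t)) → ∀ᶠ δ : ℝ in 𝓝[>] 0, (∑ γ : HexMidEdgeSAW (Λ δ) (a δ) (s δ), if ∃ v ∈
      γ.verts, r ≤ dist ((δ : ℂ) * hexCenter v) ((δ : ℂ) * hexMidpoint (a δ)) then hexCriticalFugacity ^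
      γ.length else 0) ≤ ε * ∑ γ : HexMidEdgeSAW (Λ δ) (a δ) (s δ), hexCriticalFugacity ^ γ.length) →
      (Summit.CriticalPhenomena.SAWScalingLimit.Theses.SAWLatticeVirasoro.HexSimpleSubseqLimits) →
      ObservableToSLER :=
  fun h2 h5a1 h7148 =>
  observableToSLER_of_residueMacro h2 h5a1 h7148
    Summit.CriticalPhenomena.SAWScalingLimit.Theorems.ObservableToSLER.Squeeze.carvedReduction_squeezeSolid

end Summit.CriticalPhenomena.SAWScalingLimit.Theorems.ObservableToSLER.Residue

end
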